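import Summits.BirchSwinnertonDyer.Rank1Residual.F1Sign2.RaisingLawAtTwo
import HarnessLib

/-!
# Cell `bsd-f1-sign2` — kernel bookkeeping for the -es MEMO-es §26 port (`F1Sign2/RaisingLawAtTwo.lean`)

THEOREMS ONLY (no `def`, no `sorry`, no named fact; ns `…F1Sign2.RaisingLawAtTwo` as the statement file).  Contents: (1) REF1 §185's readback certificates from
`HOME/REF1-data/b185/lean/Probe185.lean` 57bbe55f6c8ae8e4 VERBATIM (ns `REF1g17e.RaisingLawAtTwo` → `RaisingLawAtTwo`): T185a `primeStar_examples` (the sign convention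
`ℓ* = (−1)^{(ℓ−1)/2} ℓ ≡ 1 (mod 4)`; `ℓ ≡ 3, 5 (8) ⟹ ℓ* ≡ 5 (8)`, `ℓ ≡ 1, 7 (8) ⟹ ℓ* ≡ 1 (8)`), T185b `primeStar_mod_four` (for odd `ℓ`, `ℓ* ≡ 1 (4)`: the twists
`W^{(ℓ*)}`, `W^{(d_K ℓ*)}` are UNRAMIFIED at 2, so on the odd-Tamagawa slice the place 2 never enters the exceptional set `T` — REF1 lemma L185), C185a `companion_of_noRank`
(REF1's rank-free `KolyvaginPrimeTwistCompanionLawAtTwoNoRank` ⟹ -es's ES-26C verbatim, rider R185c); (2) typer glue `selmerLaw_of_noRank` (REF1 R185a form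
`KolyvaginPrimeTwistSelmerLawAtTwoNoRank` ⟹ -es's ES-26L verbatim) and the trivial compatibility `noRank_branch_of_sharp` between REF1's two preferred forms.  Typer -ty g17;
std axioms on the farm.  BSD is not proved by this; no item closed; PARTITION none.
-/

open scoped Classical
open WeierstrassCurve NumberField Finset
open Literature.NumberTheory.EllipticCurves Literature.NumberTheory.EllipticCurves.ModularForms
open Summit.BirchSwinnertonDyer.BirchSwinnertonDyer.Theorems.RankOneAtTwoOneDoor
open Summit.BirchSwinnertonDyer.Rank1Residual.F1Sign2 (LocallyTwoPowDivisible twistSelmerTwoCard ShaTwoTrivial)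
open Summit.BirchSwinnertonDyer.Rank1Residual.F1Sign2.FirstDerivativeAtTwo (IsLevelTwoKolyvaginPrime primeStar)
open Summit.BirchSwinnertonDyer.Rank1Residual.F1Sign2.KolyvaginSystemAtTwo (ClassVanishesModTwo IsLevelTwoKolyvaginLevel)

set_option autoImplicit false

namespace Summit.BirchSwinnertonDyer.Rank1Residual.F1Sign2.RaisingLawAtTwo

/-! ## REF1 §185 readback certificates (`HOME/REF1-data/b185/lean/Probe185.lean` 57bbe55f6c8ae8e4 l.236–251 and l.271–274, VERBATIM) -/

/-- T185a: `primeStar` is the fundamental-discriminant sign convention `ℓ* = (−1)^{(ℓ−1)/2} ℓ ≡ 1 (mod 4)` for odd `ℓ`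
(so `ℓ ≡ 3, 5 (mod 8) ⟹ ℓ* ≡ 5 (mod 8)`, the unramified-non-split class at `2`; `ℓ ≡ 1, 7 (mod 8) ⟹ ℓ* ≡ 1 (mod 8)`). -/
theorem primeStar_examples :
    primeStar 3 = -3 ∧ primeStar 5 = 5 ∧ primeStar 7 = -7 ∧ primeStar 11 = -11 ∧ primeStar 13 = 13 ∧
    (primeStar 3) % 8 = 5 ∧ (primeStar 5) % 8 = 5 ∧ (primeStar 7) % 8 = 1 ∧ (primeStar 11) % 8 = 5 ∧ (primeStar 13) % 8 = 5 ∧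
    (primeStar 17) % 8 = 1 ∧ (primeStar 23) % 8 = 1 := by
  simp [primeStar]

/-- T185b: for every odd `ℓ`, `primeStar ℓ ≡ 1 (mod 4)` — the twist `W^{(ℓ*)}` and `W^{(d_K ℓ*)}` (`d_K ≡ 1 (8)`) are UNRAMIFIED at `2`,
so on the odd-Tamagawa slice the place `2` never enters the exceptional set `T` (REF1 lemma L185: `c₂` odd and `ℚ₂(√D)/ℚ₂` unramified
⟹ `N E(F_w) = E(ℚ₂)` ⟹ equal Kummer conditions; -es's «residual class» `4 ∣ N`, `D ≡ 5 (8)` is covered). -/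
theorem primeStar_mod_four (ℓ : ℕ) (hℓ : ℓ % 2 = 1) : primeStar ℓ % 4 = 1 := by
  unfold primeStar
  split_ifs with h
  · omega
  · omega

/-- C185a: the rank-free companion law implies -es's ES-26C verbatim (the extra binder is discarded). -/
theorem companion_of_noRank (h : KolyvaginPrimeTwistCompanionLawAtTwoNoRank) : KolyvaginPrimeTwistCompanionLawAtTwo := by
  intro W _ _ _ hCM hsurj htor htam har hsha K _ _ hK hdoor hmin hcard g hg ℓ _ hℓ hjac hdiv D hD hsel W' _ _ C hC _ g' hg' q _ hq
  exact h W hCM hsurj htor htam har hsha K hK hdoor hmin hcard g hg ℓ hℓ hjac hdiv D hD hsel W' C hC g' hg' q hq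

/-! ## Typer glue for REF1 rider R185a: the rank-free descent law implies -es's ES-26L verbatim -/

/-- The R185a form C′ implies -es's ES-26L `KolyvaginPrimeTwistSelmerLawAtTwo` (the two `analyticRank` binders on the twists are discarded). -/
theorem selmerLaw_of_noRank (h : KolyvaginPrimeTwistSelmerLawAtTwoNoRank) : KolyvaginPrimeTwistSelmerLawAtTwo := by
  intro W _ _ _ hCM hsurj htor htam har hsha K _ _ hK hdoor hmin g hg ℓ _ hℓ hjac D D' hDD' _ _ hpos hneg
  exact h W hCM hsurj htor htam har hsha K hK hdoor hmin g hg ℓ hℓ hjac D D' hDD' hpos hneg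

/-- Bookkeeping between REF1's two preferred forms: on the `Sel₂`-trivial-door branch (`twistSelmerTwoCard W (discr K) = 1`) and `ν_ℓ(g) = 0`, the sharp law
R185b REFINES the rank-free law's disjunction `#Sel₂(W^{(D)}) ∈ {2, 8}` to `= 2` — recorded as the trivial compatibility «sharp conclusion ⟹ rank-free conclusion». -/
theorem noRank_branch_of_sharp {a b : ℕ} (h : a = 2 ∧ b = 4) : b = 4 ∧ (a = 2 ∨ a = 8) :=
  ⟨h.2, Or.inl h.1⟩

end Summit.BirchSwinnertonDyer.Rank1Residual.F1Sign2.RaisingLawAtTwo
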